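import Summits.KontsevichZagierPeriods.KontsevichZagierPeriods.Theorems.KzOnePeriodsG2SChart

/-!
# G2S derivations, part 10: the second quotient `φ₂ = (c/x² + b/3, c·y/x³)` of `y² = f(x)`, `f` even

Sub-problem `KzOnePeriods` — the theorem of Huber–Wüstholz [cite: HuberWustholz2022, Thm 13.3 (2)
(p. 121)]: every `ℚ̄`-linear relation between 1-periods is a consequence of (R1) bilinearity,
(R2) forms vanishing on the curve, (R3) exactness, (R4) functoriality along morphisms of pairs and
(R5) homotopy [cite: HuberWustholz2022, §13.1 (A)–(B) (p. 120)].  For the even sextic model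
`C_{a,b,c} : y² = f(x) = x⁶ + a x⁴ + b x² + c` one has `f(x) = x⁶·F₂(c/x² + b/3)/c²` with
`F₂ = X³ + A₂X + B₂`, `A₂ = ac − b²/3`, `B₂ = c² − abc/3 + 2b³/27` (`SplitR`), whence the second
elliptic quotient `φ₂ = (c/x² + b/3, c·y/x³) : C → E₂ = E_{A₂,B₂}` with `φ₂^*(dX/Y) = −2 dx/y`.  On the
chart model `C^w_{a,b,c} = {y² = f(x), x w = 1}` of part 9 it is the POLYNOMIAL map
`φ₂ = (c w² + b/3, c y w³)` over `ℚ̄`, so (R4) applies: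

* `phi2_mem` (`φ₂(C^w) ⊂ E₂`, from `F₂(c w² + b/3) = c²(1 + a w² + b w⁴ + c w⁶)`), the chain rule
  `phi2_pair`, and the congruence **`φ₂^*θ₀ ≡ −4·pr^*θ_1`** modulo forms vanishing on `C^w`
  (`vanishes_phi2_theta0`; `θ₀` = the representative of `dX/Y` on `E₂`, `θ_1` that of `dx/(2y)` on
  `C`; checked on every tangent line, at the branch points `y = 0` from the two Bézout identities);
* the derivation (`span_phi2`): for every path `γ` on `C_{a,b,c}` with `x ≠ 0` on `[0, 1]` and
  `γ′ = φ₂ ∘ γ` on `E₂` (`exists_phi2Path`), `(E₂, θ₀, γ′) + 4·(C, θ_1, γ) ∈ ⟨(R1)–(R5)⟩_ℚ̄` — the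
  combination `[(R1)+(R2)+(R4) along φ₂ on C^w] + (−4)·[(R4) along pr]` for the lift `γ^w` — and,
  by soundness, `∫_{γ′} dX/Y = −4·∫_γ dx/2y` (`relation_phi2`).
This is the shape of corpus relation G2-09 (`y² = (x²−1)(x²−4)(x²−11)`, `E₂′ : Y² = X³ − 1369/3·X +
89206/27`, `∫_{c₂₃⁻} dx/2y = −½·∫_{ε₂} dX/2Y`); part 11 constructs the cycles.

All statements quantify over `C¹` paths with algebraic end points (`CurvePath`).  No definitions
(local notation only), no new axioms; no statement of the programme is cited — the one citation is the
published theorem whose relation span is instantiated.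
-/

noncomputable section

open MvPolynomial Set Complex Filter Topology
open Literature.NumberTheory.Transcendental Literature.NumberTheory.Transcendental.CurvePeriods
open Summit.KontsevichZagierPeriods.KzOnePeriods.E1Derivation

namespace Summit.KontsevichZagierPeriods.KzOnePeriods.G2SDerivation

local notation3 "InSpanRel " c:arg => ∃ (k : ℕ) (ρ : Fin k → (PeriodSymbol →₀ ℂ))
  (a : Fin k → ℂ), (∀ l, IsElementaryRelation (ρ l)) ∧ (∀ l, IsAlgebraic ℚ (a l)) ∧
    c = ∑ l, a l • ρ l

/-- The symbol `(Z, ω, γ)` as an element of the formal period space. -/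
local notation3 (prettyPrint := false) "Sy[" Z ", " hZ ", " ω ", " h ", " γ "]" =>
  (Finsupp.single (⟨Z, hZ, ω, h, γ⟩ : PeriodSymbol) (1 : ℂ) : PeriodSymbol →₀ ℂ)

/-- The period `∫_γ ω` of the symbol `(Z, ω, γ)`. -/
local notation3 (prettyPrint := false) "Pe[" Z ", " hZ ", " ω ", " h ", " γ "]" =>
  PeriodSymbol.period (⟨Z, hZ, ω, h, γ⟩ : PeriodSymbol)

/-- The even sextic `f = x⁶ + a x⁴ + b x² + c ∈ ℂ[x, y]`. -/
local notation3 (prettyPrint := false) "fS[" a ", " b ", " c "]" =>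
  ((X 0 : MvPolynomial (Fin 2) ℂ) ^ 6 + C a * X 0 ^ 4 + C b * X 0 ^ 2 + C c)

/-- The affine plane model `C_{a,b,c} = {y² = f(x)} ⊂ 𝔸²`. -/
local notation3 (prettyPrint := false) "Cpl[" a ", " b ", " c "]" =>
  (⟨2, 1, ![(X 1 : MvPolynomial (Fin 2) ℂ) ^ 2 - fS[a, b, c]]⟩ : CurveData)

/-- The polynomial `Σ_k π_k x^k ∈ ℂ[x, y]` with coefficient vector `π`. -/
local notation3 (prettyPrint := false) "Pol[" π "]" =>
  (∑ k, C (π k) * (X 0 : MvPolynomial (Fin 2) ℂ) ^ (k : ℕ))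

/-- The even polynomial `U = Σ_{k<3} μ_k x^{2k}` (Bézout cofactor of `f`). -/
local notation3 (prettyPrint := false) "Upol[" μ "]" =>
  (∑ k : Fin 3, C (μ k) * (X 0 : MvPolynomial (Fin 2) ℂ) ^ (2 * (k : ℕ)))

/-- The odd polynomial `V = Σ_{k<3} ν_k x^{2k+1}` (Bézout cofactor of `f′`). -/
local notation3 (prettyPrint := false) "Vpol[" ν "]" =>
  (∑ k : Fin 3, C (ν k) * (X 0 : MvPolynomial (Fin 2) ℂ) ^ (2 * (k : ℕ) + 1))

/-- `θ[μ, ν, π] = (½ P U y) dx + (P V) dy`, the polynomial representative of `P(x) dx/(2y)`. -/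
local notation3 (prettyPrint := false) "θ[" μ ", " ν ", " π "]" =>
  (![C (1 / 2 : ℂ) * Pol[π] * Upol[μ] * X 1, Pol[π] * Vpol[ν]] :
    Fin 2 → MvPolynomial (Fin 2) ℂ)

/-- The Bézout identity `U f + V f′ = 1` (scalar form). -/
local notation3 (prettyPrint := false) "Bez[" a ", " b ", " c ", " μ ", " ν "]" =>
  (∀ x : ℂ, (∑ k : Fin 3, μ k * x ^ (2 * (k : ℕ))) * (x ^ 6 + a * x ^ 4 + b * x ^ 2 + c) +
    (∑ k : Fin 3, ν k * x ^ (2 * (k : ℕ) + 1)) * (6 * x ^ 5 + 4 * a * x ^ 3 + 2 * b * x) = 1)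

/-- `P = 1` (scalar form): `θ[μ, ν, π]` is then `θ_1`, the representative of `dx/(2y)`. -/
local notation3 (prettyPrint := false) "IsOne[" π "]" => (∀ x : ℂ, ∑ k, π k * x ^ (k : ℕ) = 1)

/-- The even sextic `f` in `ℂ[x, y, w]`. -/
local notation3 (prettyPrint := false) "fS₃[" a ", " b ", " c "]" =>
  ((X 0 : MvPolynomial (Fin 3) ℂ) ^ 6 + C a * X 0 ^ 4 + C b * X 0 ^ 2 + C c)

/-- The chart model `C^w_{a,b,c} = {y² = f(x), x·w = 1} ⊂ 𝔸³` of the open set `x ≠ 0` of `C_{a,b,c}`. -/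
local notation3 (prettyPrint := false) "Cw[" a ", " b ", " c "]" =>
  (⟨3, 2, ![(X 1 : MvPolynomial (Fin 3) ℂ) ^ 2 - fS₃[a, b, c], X 0 * X 2 - 1]⟩ : CurveData)

/-- The projection `pr = (x, y) : C^w_{a,b,c} → C_{a,b,c}` as a polynomial map. -/
local notation3 (prettyPrint := false) "proj" => (![X 0, X 1] : Fin 2 → MvPolynomial (Fin 3) ℂ)

/-- The second quotient `φ₂ = (c w² + b/3, c y w³)` (`= (c/x² + b/3, c y/x³)` on `x w = 1`). -/
local notation3 (prettyPrint := false) "phi2[" b ", " c "]" =>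
  (![C c * X 2 ^ 2 + C (b / 3), C c * X 1 * X 2 ^ 3] : Fin 2 → MvPolynomial (Fin 3) ℂ)

/-- `f(x) = x⁶ F(c/x² + b/3)/c²` with `F = X³ + AX + B`: the coefficients of the second quotient. -/
local notation3 (prettyPrint := false) "SplitR[" a ", " b ", " c ", " A ", " B "]" =>
  ((A : ℂ) = a * c - b ^ 2 / 3 ∧ (B : ℂ) = c ^ 2 - a * b * c / 3 + 2 * b ^ 3 / 27)

variable {a b c : ℂ}
/-! ### The second quotient `φ₂ = (c w² + b/3, c y w³) : C^w → E_{A,B}` -/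

/-- `φ₂` is defined over `ℚ̄` for `b, c ∈ ℚ̄`. -/
theorem hasAlgCoeffs_phi2 (hb : IsAlgebraic ℚ b) (hc : IsAlgebraic ℚ c) :
    ∀ j, HasAlgCoeffs ((phi2[b, c]) j) := fun j => by
  have hb3 : IsAlgebraic ℚ (b / 3) := by
    rw [div_eq_mul_inv]; exact hb.mul (isAlgebraic_nat 3).inv
  fin_cases j
  · simpa using ((hasAlgCoeffs_C hc).mul ((hasAlgCoeffs_X (n := 3) 2).pow 2)).add (hasAlgCoeffs_C hb3)
  · simpa using ((hasAlgCoeffs_C hc).mul (hasAlgCoeffs_X (n := 3) 1)).mul ((hasAlgCoeffs_X 2).pow 3)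

/-- `φ₂(z) = (c z₂² + b/3, c z₁ z₂³)`. -/
theorem eval_phi2 (z : Fin 3 → ℂ) :
    (fun j => eval z ((phi2[b, c]) j)) = ![c * z 2 ^ 2 + b / 3, c * z 1 * z 2 ^ 3] := by
  funext j
  fin_cases j <;> simp

/-- `φ₂` maps `C^w_{a,b,c}` into `E_{A,B}` (`F(c w² + b/3) = c²(1 + a w² + b w⁴ + c w⁶) = c² w⁶ f(x)` on
`x w = 1`). -/
theorem phi2_mem {A B : ℂ} (hsp : SplitR[a, b, c, A, B]) :
    ∀ z ∈ Cw[a, b, c].points, (fun j => eval z ((phi2[b, c]) j)) ∈ (weierCurve A B).points := by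
  intro z hz
  obtain ⟨hA, hB⟩ := hsp
  obtain ⟨hz1, hz2⟩ := (mem_pointsW_iff z).1 hz
  rw [eval_phi2, Weier.mem_points_iff, Weier.eval_fPoly]
  simp only [Matrix.cons_val_zero, Matrix.cons_val_one]
  rw [hA, hB]
  linear_combination (c ^ 2 * z 2 ^ 6) * hz1 +
    (c ^ 2 * ((1 + z 0 * z 2 + (z 0 * z 2) ^ 2 + (z 0 * z 2) ^ 3 + (z 0 * z 2) ^ 4 + (z 0 * z 2) ^ 5) +
      a * z 2 ^ 2 * (1 + z 0 * z 2 + (z 0 * z 2) ^ 2 + (z 0 * z 2) ^ 3) +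
      b * z 2 ^ 4 * (1 + z 0 * z 2))) * hz2

/-- The Jacobian of `φ₂` at `z`. -/
theorem eval_pderiv_phi2 (z : Fin 3 → ℂ) (i : Fin 3) (j : Fin 2) :
    eval z (pderiv i ((phi2[b, c]) j)) =
      (![![0, 0], ![0, c * z 2 ^ 3], ![2 * c * z 2, 3 * c * z 1 * z 2 ^ 2]] : Fin 3 → Fin 2 → ℂ) i j := by
  fin_cases i <;> fin_cases j <;>
    simp [Derivation.leibniz, Derivation.leibniz_pow, pderiv_X, smul_eq_mul, nsmul_eq_mul] <;> ring

/-- The chain rule for `φ₂`: `(φ₂^*ω′)(z)(v) = ω′(φ₂ z)(2c z₂ v₂, c z₂³ v₁ + 3c z₁ z₂² v₂)`. -/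
theorem phi2_pair (ω' : Fin 2 → MvPolynomial (Fin 2) ℂ) (z v : Fin 3 → ℂ) :
    ∑ i, eval z (formPullback (phi2[b, c]) ω' i) * v i =
      eval (![c * z 2 ^ 2 + b / 3, c * z 1 * z 2 ^ 3]) (ω' 0) * (2 * c * z 2 * v 2) +
        eval (![c * z 2 ^ 2 + b / 3, c * z 1 * z 2 ^ 3]) (ω' 1) *
          (c * z 2 ^ 3 * v 1 + 3 * c * z 1 * z 2 ^ 2 * v 2) := by
  rw [formPullback_pair, eval_phi2]
  simp only [Fin.sum_univ_two, Fin.sum_univ_three, eval_pderiv_phi2, Matrix.cons_val_zero,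
    Matrix.cons_val_one, Matrix.cons_val_two, Matrix.head_cons, Matrix.tail_cons]
  ring

/-! ### `φ₂^*(dX/Y) ≡ −2 dx/y` on `C^w` -/

/-- **`φ₂^*(dX/Y) ≡ −4·θ_1` on `C^w_{a,b,c}`.**  With `θ₀ = θ₀[A, B]` the polynomial representative of
`dX/Y` on `E_{A,B}` (`CurvePeriodsEllipticFormsProofs`) and `θ[μ, ν, π]`, `P = 1`, that of `dx/(2y)` on
`C_{a,b,c}` (`U f + V f′ = 1`), the form `φ₂^*θ₀ + 4·pr^*θ_1` vanishes on every tangent line of `C^w`: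
at the points `y ≠ 0` both `φ₂^*θ₀` and `−4 pr^*θ_1` restrict to `−2 dx/y` (`dX = 2cw dw = −2cw³ dx`,
`Y = c y w³`); at the branch points `y = 0` the tangent line is `dx = dw = 0` and the `dy`-coefficients
agree, `(2/D)·V_E(X)·c w³ = 2c w³/F′(X) = −4/f′(x) = −4·V(x)` (`c w³ f′(x) = −2F′(X)` at `f(x) = 0`), by
the Bézout identities of `E` (`V_E F′ − U_E F = D`) and of `C`. -/
theorem vanishes_phi2_theta0 {A B : ℂ} (hsp : SplitR[a, b, c, A, B]) (hD : Weier.disc A B ≠ 0)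
    {μ ν : Fin 3 → ℂ} (hbez : Bez[a, b, c, μ, ν]) {N : ℕ} {π : Fin N → ℂ} (hπ : IsOne[π]) :
    VanishesOn Cw[a, b, c]
      (formPullback (phi2[b, c]) (Weier.theta0 A B) - (-4 : ℂ) • formPullback (proj) θ[μ, ν, π]) := by
  obtain ⟨rfl, rfl⟩ := hsp
  intro z hz v hv
  obtain ⟨hz1, hz2⟩ := (mem_pointsW_iff z).1 hz
  obtain ⟨hv1, hv2⟩ := (mem_tangentSpaceW_iff z v).1 hv
  have hB := hbez (z 0)
  have hP := hπ (z 0)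
  have cancel : ∀ {q w : ℂ}, q ≠ 0 → q * w = 0 → w = 0 := fun hq h =>
    (mul_eq_zero.1 h).resolve_left hq
  -- split `Σ_i` into the pull-back pairing along `φ₂` and the pairing of `4·pr^*θ_1`
  have hsplit : ∑ i, eval z ((formPullback (phi2[b, c])
      (Weier.theta0 (a * c - b ^ 2 / 3) (c ^ 2 - a * b * c / 3 + 2 * b ^ 3 / 27)) -
        (-4 : ℂ) • formPullback (proj) θ[μ, ν, π]) i) * v i =
      (∑ i, eval z (formPullback (phi2[b, c])
        (Weier.theta0 (a * c - b ^ 2 / 3) (c ^ 2 - a * b * c / 3 + 2 * b ^ 3 / 27)) i) * v i) +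
        4 * (∑ i, eval z (formPullback (proj) θ[μ, ν, π] i) * v i) := by
    simp only [Fin.sum_univ_three, Pi.sub_apply, Pi.smul_apply, map_sub, smul_eval]
    ring
  rw [hsplit, phi2_pair, proj_pair]
  simp only [Weier.theta0, Weier.uPol, Weier.vPol, Matrix.cons_val_zero, Matrix.cons_val_one,
    map_mul, map_sub, map_add, map_pow, eval_C, eval_X, eval_Pol, eval_Upol, eval_Vpol, hP]
  set D := Weier.disc (a * c - b ^ 2 / 3) (c ^ 2 - a * b * c / 3 + 2 * b ^ 3 / 27) with hDdef
  set U := ∑ k : Fin 3, μ k * z 0 ^ (2 * (k : ℕ)) with hU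
  set V := ∑ k : Fin 3, ν k * z 0 ^ (2 * (k : ℕ) + 1) with hV
  have hT : D * (1 / D) = 1 := mul_one_div_cancel hD
  have hBE : (6 * (a * c - b ^ 2 / 3) * (c * z 2 ^ 2 + b / 3) ^ 2 -
      9 * (c ^ 2 - a * b * c / 3 + 2 * b ^ 3 / 27) * (c * z 2 ^ 2 + b / 3) +
      4 * (a * c - b ^ 2 / 3) ^ 2) * (3 * (c * z 2 ^ 2 + b / 3) ^ 2 + (a * c - b ^ 2 / 3)) -
      (18 * (a * c - b ^ 2 / 3) * (c * z 2 ^ 2 + b / 3) - 27 * (c ^ 2 - a * b * c / 3 + 2 * b ^ 3 / 27)) *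
      ((c * z 2 ^ 2 + b / 3) ^ 3 + (a * c - b ^ 2 / 3) * (c * z 2 ^ 2 + b / 3) +
        (c ^ 2 - a * b * c / 3 + 2 * b ^ 3 / 27)) = D := by
    simp only [hDdef, Weier.disc]; ring
  -- abbreviations used in the certificates (all definitional, closed by `ring`)
  -- `q₁`, `q₂`: `F(X) − c²w⁶f = (xw − 1)·q₁`, `F′(X) − (3cw⁴f − ½cw³f′) = (xw − 1)·q₂`
  by_cases hy : z 1 = 0
  · -- branch point: `f(z₀) = 0`, `V f′ = 1`, `f′(z₀) ≠ 0`
    have hf0 : z 0 ^ 6 + a * z 0 ^ 4 + b * z 0 ^ 2 + c = 0 := by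
      linear_combination -hz1 + z 1 * hy
    have hVf : V * (6 * z 0 ^ 5 + 4 * a * z 0 ^ 3 + 2 * b * z 0) = 1 := by
      linear_combination hB - U * hf0
    have hf' : (6 * z 0 ^ 5 + 4 * a * z 0 ^ 3 + 2 * b * z 0) ≠ 0 := fun h0 =>
      zero_ne_one (by linear_combination hVf - V * h0)
    refine cancel (mul_ne_zero hf' hD) ?_
    linear_combination
      ((6 * z 0 ^ 5 + 4 * a * z 0 ^ 3 + 2 * b * z 0) *
          (-(18 * (a * c - b ^ 2 / 3) * (c * z 2 ^ 2 + b / 3) -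
              27 * (c ^ 2 - a * b * c / 3 + 2 * b ^ 3 / 27)) * (c * z 1 * z 2 ^ 3) *
              (2 * c * z 2 * v 2) +
            2 * (6 * (a * c - b ^ 2 / 3) * (c * z 2 ^ 2 + b / 3) ^ 2 -
              9 * (c ^ 2 - a * b * c / 3 + 2 * b ^ 3 / 27) * (c * z 2 ^ 2 + b / 3) +
              4 * (a * c - b ^ 2 / 3) ^ 2) * (c * z 2 ^ 3 * v 1 + 3 * c * z 1 * z 2 ^ 2 * v 2))) * hT +
      (-2 * c ^ 2 * z 2 ^ 4 * (18 * (a * c - b ^ 2 / 3) * (c * z 2 ^ 2 + b / 3) -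
            27 * (c ^ 2 - a * b * c / 3 + 2 * b ^ 3 / 27)) *
            (6 * z 0 ^ 5 + 4 * a * z 0 ^ 3 + 2 * b * z 0) * v 2 +
          6 * c * z 2 ^ 2 * (6 * (a * c - b ^ 2 / 3) * (c * z 2 ^ 2 + b / 3) ^ 2 -
            9 * (c ^ 2 - a * b * c / 3 + 2 * b ^ 3 / 27) * (c * z 2 ^ 2 + b / 3) +
            4 * (a * c - b ^ 2 / 3) ^ 2) * (6 * z 0 ^ 5 + 4 * a * z 0 ^ 3 + 2 * b * z 0) * v 2 +
          2 * (6 * z 0 ^ 5 + 4 * a * z 0 ^ 3 + 2 * b * z 0) * D * U * v 0) * hy +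
      (4 * D * v 1) * hVf +
      (12 * c * z 2 ^ 4 * (6 * (a * c - b ^ 2 / 3) * (c * z 2 ^ 2 + b / 3) ^ 2 -
            9 * (c ^ 2 - a * b * c / 3 + 2 * b ^ 3 / 27) * (c * z 2 ^ 2 + b / 3) +
            4 * (a * c - b ^ 2 / 3) ^ 2) * v 1 -
          4 * c ^ 2 * z 2 ^ 6 * (18 * (a * c - b ^ 2 / 3) * (c * z 2 ^ 2 + b / 3) -
            27 * (c ^ 2 - a * b * c / 3 + 2 * b ^ 3 / 27)) * v 1) * hf0 +
      (4 * (6 * (a * c - b ^ 2 / 3) * (c * z 2 ^ 2 + b / 3) ^ 2 -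
            9 * (c ^ 2 - a * b * c / 3 + 2 * b ^ 3 / 27) * (c * z 2 ^ 2 + b / 3) +
            4 * (a * c - b ^ 2 / 3) ^ 2) *
            (-3 * c * z 2 ^ 3 * z 0 ^ 5 -
              a * c * (3 * (z 0 * z 2) ^ 3 + (z 0 * z 2) ^ 2 + z 0 * z 2 + 1) -
              b * c * z 2 ^ 2 * (3 * (z 0 * z 2) + 2)) * v 1 -
          4 * (18 * (a * c - b ^ 2 / 3) * (c * z 2 ^ 2 + b / 3) -
            27 * (c ^ 2 - a * b * c / 3 + 2 * b ^ 3 / 27)) *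
            (-c ^ 2 * ((1 + z 0 * z 2 + (z 0 * z 2) ^ 2 + (z 0 * z 2) ^ 3 + (z 0 * z 2) ^ 4 +
                (z 0 * z 2) ^ 5) +
              a * z 2 ^ 2 * (1 + z 0 * z 2 + (z 0 * z 2) ^ 2 + (z 0 * z 2) ^ 3) +
              b * z 2 ^ 4 * (1 + z 0 * z 2))) * v 1) * hz2 +
      (-4 * v 1) * hBE
  · -- ordinary point: multiply by `z₁ D` and use the tangent equations
    refine cancel (mul_ne_zero hy hD) ?_
    linear_combination
      (z 1 * (-(18 * (a * c - b ^ 2 / 3) * (c * z 2 ^ 2 + b / 3) -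
              27 * (c ^ 2 - a * b * c / 3 + 2 * b ^ 3 / 27)) * (c * z 1 * z 2 ^ 3) *
              (2 * c * z 2 * v 2) +
            2 * (6 * (a * c - b ^ 2 / 3) * (c * z 2 ^ 2 + b / 3) ^ 2 -
              9 * (c ^ 2 - a * b * c / 3 + 2 * b ^ 3 / 27) * (c * z 2 ^ 2 + b / 3) +
              4 * (a * c - b ^ 2 / 3) ^ 2) * (c * z 2 ^ 3 * v 1 + 3 * c * z 1 * z 2 ^ 2 * v 2))) * hT +
      (c * z 2 ^ 3 * (6 * (a * c - b ^ 2 / 3) * (c * z 2 ^ 2 + b / 3) ^ 2 -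
            9 * (c ^ 2 - a * b * c / 3 + 2 * b ^ 3 / 27) * (c * z 2 ^ 2 + b / 3) +
            4 * (a * c - b ^ 2 / 3) ^ 2) + 2 * D * V) * hv1 +
      (-2 * c ^ 2 * z 2 ^ 4 * (18 * (a * c - b ^ 2 / 3) * (c * z 2 ^ 2 + b / 3) -
            27 * (c ^ 2 - a * b * c / 3 + 2 * b ^ 3 / 27)) * v 2 +
          6 * c * z 2 ^ 2 * (6 * (a * c - b ^ 2 / 3) * (c * z 2 ^ 2 + b / 3) ^ 2 -
            9 * (c ^ 2 - a * b * c / 3 + 2 * b ^ 3 / 27) * (c * z 2 ^ 2 + b / 3) +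
            4 * (a * c - b ^ 2 / 3) ^ 2) * v 2 + 2 * D * U * v 0) * hz1 +
      (2 * D * v 0) * hB +
      ((-2 * c ^ 2 * z 2 ^ 4 * (18 * (a * c - b ^ 2 / 3) * (c * z 2 ^ 2 + b / 3) -
            27 * (c ^ 2 - a * b * c / 3 + 2 * b ^ 3 / 27)) *
            (z 0 ^ 6 + a * z 0 ^ 4 + b * z 0 ^ 2 + c) +
          6 * c * z 2 ^ 2 * (6 * (a * c - b ^ 2 / 3) * (c * z 2 ^ 2 + b / 3) ^ 2 -
            9 * (c ^ 2 - a * b * c / 3 + 2 * b ^ 3 / 27) * (c * z 2 ^ 2 + b / 3) +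
            4 * (a * c - b ^ 2 / 3) ^ 2) * (z 0 ^ 6 + a * z 0 ^ 4 + b * z 0 ^ 2 + c)) * z 2) * hv2 +
      (-(-2 * c ^ 2 * z 2 ^ 4 * (18 * (a * c - b ^ 2 / 3) * (c * z 2 ^ 2 + b / 3) -
            27 * (c ^ 2 - a * b * c / 3 + 2 * b ^ 3 / 27)) *
            (z 0 ^ 6 + a * z 0 ^ 4 + b * z 0 ^ 2 + c) +
          6 * c * z 2 ^ 2 * (6 * (a * c - b ^ 2 / 3) * (c * z 2 ^ 2 + b / 3) ^ 2 -
            9 * (c ^ 2 - a * b * c / 3 + 2 * b ^ 3 / 27) * (c * z 2 ^ 2 + b / 3) +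
            4 * (a * c - b ^ 2 / 3) ^ 2) * (z 0 ^ 6 + a * z 0 ^ 4 + b * z 0 ^ 2 + c)) * v 2 +
          (-2 * (18 * (a * c - b ^ 2 / 3) * (c * z 2 ^ 2 + b / 3) -
              27 * (c ^ 2 - a * b * c / 3 + 2 * b ^ 3 / 27)) *
              (-c ^ 2 * ((1 + z 0 * z 2 + (z 0 * z 2) ^ 2 + (z 0 * z 2) ^ 3 + (z 0 * z 2) ^ 4 +
                  (z 0 * z 2) ^ 5) +
                a * z 2 ^ 2 * (1 + z 0 * z 2 + (z 0 * z 2) ^ 2 + (z 0 * z 2) ^ 3) +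
                b * z 2 ^ 4 * (1 + z 0 * z 2))) +
            2 * (6 * (a * c - b ^ 2 / 3) * (c * z 2 ^ 2 + b / 3) ^ 2 -
              9 * (c ^ 2 - a * b * c / 3 + 2 * b ^ 3 / 27) * (c * z 2 ^ 2 + b / 3) +
              4 * (a * c - b ^ 2 / 3) ^ 2) *
              (-3 * c * z 2 ^ 3 * z 0 ^ 5 -
                a * c * (3 * (z 0 * z 2) ^ 3 + (z 0 * z 2) ^ 2 + z 0 * z 2 + 1) -
                b * c * z 2 ^ 2 * (3 * (z 0 * z 2) + 2))) * v 0) * hz2 +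
      (-2 * v 0) * hBE

/-! ### The derivation `(E_{A,B}, θ₀, φ₂∘γ) + 4·(C_{a,b,c}, θ_1, γ) ∈ ⟨(R1)–(R5)⟩_ℚ̄` -/

/-- The image path `φ₂ ∘ γ = (c/x² + b/3, c y/x³)` on `E_{A,B}` of a path `γ` on `C_{a,b,c}` avoiding
`x = 0` (through the chart: `φ₂ ∘ γ^w`). -/
theorem exists_phi2Path {A B : ℂ} (hb : IsAlgebraic ℚ b) (hc : IsAlgebraic ℚ c)
    (hsp : SplitR[a, b, c, A, B]) {γ : CurvePath Cpl[a, b, c]}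
    (h0 : ∀ t ∈ Icc (0 : ℝ) 1, γ.toFun t 0 ≠ 0) :
    ∃ γ' : CurvePath (weierCurve A B), ∀ t, γ'.toFun t =
      ![c * (γ.toFun t 0)⁻¹ ^ 2 + b / 3, c * γ.toFun t 1 * (γ.toFun t 0)⁻¹ ^ 3] := by
  obtain ⟨γw, hγw⟩ := exists_chartPath h0
  obtain ⟨γ', hγ'⟩ := exists_imagePath (Z := Cw[a, b, c]) (Z' := weierCurve A B) (phi2[b, c])
    (hasAlgCoeffs_phi2 hb hc) (phi2_mem hsp) γw
  refine ⟨γ', fun t => ?_⟩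
  rw [hγ' t, eval_phi2, hγw t]
  simp

/-- **The second-quotient derivation.**  For algebraic data (`a, b, c, μ, ν, π ∈ ℚ̄`, `U f + V f′ = 1`,
`P = 1`, `A = ac − b²/3`, `B = c² − abc/3 + 2b³/27`, `4A³ + 27B² ≠ 0`), every path `γ` on `C_{a,b,c}`
with `x ≠ 0` on `[0, 1]` and `γ′ = φ₂ ∘ γ = (c/x² + b/3, c y/x³)` on `E_{A,B}`:
`(E_{A,B}, θ₀, γ′) − (−4)·(C_{a,b,c}, θ_1, γ) ∈ ⟨(R1)–(R5)⟩_ℚ̄` — the combination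
`[(R1)+(R2)+(R4) along φ₂ : C^w → E] + (−4)·[(R4) along pr : C^w → C]` for the lift `γ^w` of `γ`. -/
theorem span_phi2 (ha : IsAlgebraic ℚ a) (hb : IsAlgebraic ℚ b) (hc : IsAlgebraic ℚ c)
    {μ ν : Fin 3 → ℂ} (hμ : ∀ k, IsAlgebraic ℚ (μ k)) (hν : ∀ k, IsAlgebraic ℚ (ν k))
    (hbez : Bez[a, b, c, μ, ν]) {N : ℕ} {π : Fin N → ℂ} (hπa : ∀ k, IsAlgebraic ℚ (π k))
    (hπ : IsOne[π]) {A B : ℂ} (hA : IsAlgebraic ℚ A) (hB : IsAlgebraic ℚ B)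
    (hD : Weier.disc A B ≠ 0) (hsp : SplitR[a, b, c, A, B]) {γ : CurvePath Cpl[a, b, c]}
    (h0 : ∀ t ∈ Icc (0 : ℝ) 1, γ.toFun t 0 ≠ 0) {γ' : CurvePath (weierCurve A B)}
    (hγ' : ∀ t ∈ Icc (0 : ℝ) 1, γ'.toFun t =
      ![c * (γ.toFun t 0)⁻¹ ^ 2 + b / 3, c * γ.toFun t 1 * (γ.toFun t 0)⁻¹ ^ 3]) :
    InSpanRel (Sy[weierCurve A B, Weier.isSmoothAffineCurve A B hA hB hD, Weier.theta0 A B,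
        Weier.hasAlgCoeffs_theta0 A B hA hB, γ'] -
      (-4 : ℂ) • Sy[Cpl[a, b, c], smooth ha hb hc hbez, θ[μ, ν, π], hasAlgCoeffs_theta hμ hν hπa, γ]) := by
  obtain ⟨γw, hγw⟩ := exists_chartPath h0
  have hW := smoothW ha hb hc hbez
  have hpθ : ∀ i, HasAlgCoeffs (formPullback (proj) θ[μ, ν, π] i) :=
    HasAlgCoeffs.formPullback hasAlgCoeffs_proj (hasAlgCoeffs_theta hμ hν hπa)
  have h4 : IsAlgebraic ℚ (-4 : ℂ) := by exact_mod_cast isAlgebraic_int (-4)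
  -- (R1)+(R2)+(R4) along `φ₂` on the chart
  have key := span_image_of_formPullback_vanish hW (Weier.isSmoothAffineCurve A B hA hB hD)
    (phi2[b, c]) (hasAlgCoeffs_phi2 hb hc) (phi2_mem hsp) (Weier.theta0 A B)
    (Weier.hasAlgCoeffs_theta0 A B hA hB) (formPullback (proj) θ[μ, ν, π]) hpθ h4
    (vanishes_phi2_theta0 hsp hD hbez hπ) (γ := γw) (γ' := γ')
    fun t ht => by rw [hγ' t ht, eval_phi2, hγw t]; simp
  -- (R4) along the projection `pr : C^w → C`
  have r := IsElementaryRelation.pushforward Cw[a, b, c] Cpl[a, b, c] hW (smooth ha hb hc hbez)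
    (proj) hasAlgCoeffs_proj proj_mem θ[μ, ν, π] (hasAlgCoeffs_theta hμ hν hπa)
    (formPullback (proj) θ[μ, ν, π]) hpθ rfl γw γ
    fun t _ => by rw [eval_proj, hγw t]; funext j; fin_cases j <;> simp
  obtain ⟨k, ρ, w, hρ, hw, hs⟩ := span_add key (span_smul h4 (span_of_rel r))
  exact ⟨k, ρ, w, hρ, hw, by rw [← hs]; module⟩

/-- … and `∫_{φ₂∘γ} dX/Y = −4·∫_γ θ_1` (`= −2 ∫_γ dx/y`). -/
theorem relation_phi2 (ha : IsAlgebraic ℚ a) (hb : IsAlgebraic ℚ b) (hc : IsAlgebraic ℚ c)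
    {μ ν : Fin 3 → ℂ} (hμ : ∀ k, IsAlgebraic ℚ (μ k)) (hν : ∀ k, IsAlgebraic ℚ (ν k))
    (hbez : Bez[a, b, c, μ, ν]) {N : ℕ} {π : Fin N → ℂ} (hπa : ∀ k, IsAlgebraic ℚ (π k))
    (hπ : IsOne[π]) {A B : ℂ} (hA : IsAlgebraic ℚ A) (hB : IsAlgebraic ℚ B)
    (hD : Weier.disc A B ≠ 0) (hsp : SplitR[a, b, c, A, B]) {γ : CurvePath Cpl[a, b, c]}
    (h0 : ∀ t ∈ Icc (0 : ℝ) 1, γ.toFun t 0 ≠ 0) {γ' : CurvePath (weierCurve A B)}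
    (hγ' : ∀ t ∈ Icc (0 : ℝ) 1, γ'.toFun t =
      ![c * (γ.toFun t 0)⁻¹ ^ 2 + b / 3, c * γ.toFun t 1 * (γ.toFun t 0)⁻¹ ^ 3]) :
    Pe[weierCurve A B, Weier.isSmoothAffineCurve A B hA hB hD, Weier.theta0 A B,
        Weier.hasAlgCoeffs_theta0 A B hA hB, γ'] =
      -4 * Pe[Cpl[a, b, c], smooth ha hb hc hbez, θ[μ, ν, π], hasAlgCoeffs_theta hμ hν hπa, γ] := by
  obtain ⟨k, ρ, w, hρ, hw, hs⟩ := span_phi2 ha hb hc hμ hν hbez hπa hπ hA hB hD hsp h0 hγ'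
  have h0 := evalCombination_eq_zero_of_isElementaryRelation ρ w hρ
  rw [← hs, sub_eq_add_neg, ← neg_smul, evalCombination_add, evalCombination_smul,
    evalCombination_single, evalCombination_single] at h0
  linear_combination h0

end Summit.KontsevichZagierPeriods.KzOnePeriods.G2SDerivation

end
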